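import Summits.CriticalPhenomena.Ising3DConformalLimit.Theses.ReflectionTwin
import Summits.CriticalPhenomena.Ising3DConformalLimit.Theses.LogPolarProxy
import Summits.CriticalPhenomena.Ising3DConformalLimit.Theorems.ReflectionTwinExistsContinuousLimitSplit
import Summits.CriticalPhenomena.Ising3DConformalLimit.Theorems.LogPolarProxyExistsContinuousLimitDoublingSplit
import Summits.CriticalPhenomena.Ising3DConformalLimit.Theorems.ReflectionTwinExistsContinuousLimitCubeChain
import Literature.Probability.LatticeModels.CriticalTwoPointDCPLowerTorus
import Literature.Probability.LatticeModels.PointwiseScalingLimitEtaExists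
import HarnessLib

/-!
# Addendum sketch (strategist s1, compaction-resumed instance) — crux `ExistsContinuousLimit` (item stmt-CriticalPhenomena-4582)

Kernel-checked companions to `STRATEGY-CENSUS.md` (strategist s1, 2026-08-17T18:45Z) §0 / D-s1-1 / D-s1-2(ii) / N-s1-3 and to the
lead c7 HANDOFF goal (F1). Sorry-free; nothing here is registered as a line or a stub (the live skeleton `Lines/free_box_deficit.lean`
is untouched).

* §D  the DECOMPOSITION by name through the route-file-free glue p172795
  (`Cruxes.ExistsContinuousLimit.SplitGlue.ExistsContinuousLimit_of_subs`): items 6150 ∧ 4659 ⟹ both route copies of the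
  crux, and exactness (p149785).
* §S  the lead's stuck goal `CubeDeficit` (= `stub_cubeDeficit` verbatim, `cubeDeficit_iff_stub`), its weak form `WeakCubeDeficit`
  (c7's (F1)) and the COMPARABLE-SCALE half-space image inequality `HalfSpaceImageDeficit` (the form of c7's reverse-image
  inequality that survives the scaling objection N-s1-3, since `|x−y| = n ≍ dist(∂)`), with the PROVED bookkeeping
  `HalfSpaceImageDeficit → WeakCubeDeficit` (ONE fold: GKS domain monotonicity `free_{C_n} ≤ free_{S_{n,n}}`),
  `CubeDeficit → WeakCubeDeficit` (MMS axis antitonicity), `WeakCubeDeficit → TwoPointDoubling → CubeDeficit`,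
  `CubeDeficit → TwoPointDoubling` (landed cube chain p172128): hence
  **`CubeDeficit ⟺ WeakCubeDeficit ∧ TwoPointDoubling`** (`cubeDeficit_iff_weak_and_doubling`) — the census sentence
  "the residual stub is ⟺ 6150 iff F1 holds", as a theorem: the stub is item 6150 plus a free-boundary (ordinary-surface-transition)
  statement that the infinite-volume crux does not imply.
-/

noncomputable section

namespace Summit.CriticalPhenomena.Ising3DConformalLimit.Cruxes.ExistsContinuousLimit.StrategistS1Addendum

open Literature.Probability.LatticeModels
open Summit.CriticalPhenomena.Ising3DConformalLimit.Theses

/-! ## §D — the split, by name -/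

/-- Items 6150 ∧ 4659 ⟹ the `ReflectionTwin` copy of the crux, through the route-file-free glue p172795 (this is the term the
gate renders as `ExistsContinuousLimitGlueBy_holds` after `route edit --split … --glue-by`). [folklore] -/
theorem reflectionTwin_of_items (hD : MirrorHoelderCompactness.TwoPointDoubling)
    (hT : ClusterRigidity.ClusterSetTotallyDisconnected) : ReflectionTwin.ExistsContinuousLimit :=
  SplitGlue.ExistsContinuousLimit_of_subs hD hT

/-- Items 6150 ∧ 4659 ⟹ the `LogPolarProxy` copy of the crux (same term). [folklore] -/
theorem logPolarProxy_of_items (hD : MirrorHoelderCompactness.TwoPointDoubling)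
    (hT : ClusterRigidity.ClusterSetTotallyDisconnected) : LogPolarProxy.ExistsContinuousLimit :=
  SplitGlue.ExistsContinuousLimit_of_subs hD hT

/-- Exactness of the split (p149785 = p146967 ∘ p139907). [folklore] -/
theorem split_exact : ReflectionTwin.ExistsContinuousLimit ↔
    MirrorHoelderCompactness.TwoPointDoubling ∧ ClusterRigidity.ClusterSetTotallyDisconnected :=
  LogPolarProxyExistsContinuousLimit.reflectionTwin_existsContinuousLimit_iff_doubling_and_totallyDisconnected

/-! ## §S — the stuck goal and its neighbours -/

/-- The cube `C_n = {1−h ≤ z₀ ≤ n+h−1, |z₁|,|z₂| ≤ n−1}`, `h = ⌈n/2⌉`, of the lead's stub (verbatim term). -/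
def cube (n : ℕ) : Finset (Site 3) :=
  Fintype.piFinset fun i : Fin 3 => Finset.Icc
    ((fun i : Fin 3 => if i = 0 then 1 - (((n + 1) / 2 : ℕ) : ℤ) else 1 - (n : ℤ)) i)
    ((fun i : Fin 3 => if i = 0 then (n : ℤ) + (((n + 1) / 2 : ℕ) : ℤ) - 1 else (n : ℤ) - 1) i)

/-- The half-space slab `S_{n,L} = {−L ≤ z₀ ≤ n+h−1, |z₁|,|z₂| ≤ L}` (finite-volume stand-in for the half-space `{z₀ ≤ n+h−1}`;
by GKS the free two-point function increases in `L`, so quantifying over all `L ≥ n` is the half-space statement). -/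
def slab (n L : ℕ) : Finset (Site 3) :=
  Fintype.piFinset fun i : Fin 3 => Finset.Icc
    ((fun _ : Fin 3 => -(L : ℤ)) i)
    ((fun i : Fin 3 => if i = 0 then (n : ℤ) + (((n + 1) / 2 : ℕ) : ℤ) - 1 else (L : ℤ)) i)

/-- Free two-point function `⟨σ₀ σ_{ne₀}⟩^free_{Λ, β_c(3)}`. -/
def freeTP (Λ : Finset (Site 3)) (n : ℕ) : ℝ :=
  isingTwoPoint (zdGraph 3) Λ (criticalBeta 3) 0 .free 0 (Pi.single 0 (n : ℤ))

/-- Axis two-point function `g(z) = G_{β_c(3)}(z e₀)`. -/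
def g (z : ℤ) : ℝ := criticalTwoPoint 3 (Pi.single 0 z)

/-- The lead's stub `stub_cubeDeficit`, up to the abbreviations (see `cubeDeficit_iff_stub`). -/
def CubeDeficit : Prop := ∃ c : ℝ, 0 < c ∧ ∀ n : ℕ, 1 ≤ n → freeTP (cube n) n ≤ (1 - c) * g n

/-- `CubeDeficit` is the registered stub verbatim. -/
theorem cubeDeficit_iff_stub : CubeDeficit ↔
    (∃ c : ℝ, 0 < c ∧ ∀ n : ℕ, 1 ≤ n → isingTwoPoint (zdGraph 3) (Fintype.piFinset fun i : Fin 3 => Finset.Icc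
      ((fun i : Fin 3 => if i = 0 then 1 - (((n + 1) / 2 : ℕ) : ℤ) else 1 - (n : ℤ)) i)
      ((fun i : Fin 3 => if i = 0 then (n : ℤ) + (((n + 1) / 2 : ℕ) : ℤ) - 1 else (n : ℤ) - 1) i))
      (criticalBeta 3) 0 .free 0 (Pi.single 0 (n : ℤ)) ≤ (1 - c) * criticalTwoPoint 3 (Pi.single 0 (n : ℤ))) :=
  Iff.rfl

/-- (F1) `WeakCubeDeficit` (lead c7 §farm): the deficit is at least `c'·g(2n)`. -/
def WeakCubeDeficit : Prop := ∃ c : ℝ, 0 < c ∧ ∀ n : ℕ, 1 ≤ n → c * g (2 * (n : ℤ)) ≤ g n - freeTP (cube n) n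

/-- Comparable-scale half-space image inequality (finite-volume form; the version of c7's reverse-image inequality that keeps
`|x−y| = n ≍ dist(∂)`, cf. census N-s1-3): free boundary conditions on the plane
`z₀ = n+h−½` alone cost at least `c·g(2n)` (`≍` the image term `G(0, R(ne₀))`, `R(ne₀) = (n+2h−1)e₀`) at the point `ne₀`. -/
def HalfSpaceImageDeficit : Prop :=
  ∃ c : ℝ, 0 < c ∧ ∀ n : ℕ, 1 ≤ n → ∀ L : ℕ, n ≤ L → c * g (2 * (n : ℤ)) ≤ g n - freeTP (slab n L) n

theorem mem_cube_zero {n : ℕ} (hn : 1 ≤ n) : (0 : Site 3) ∈ cube n := by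
  simp only [cube, Fintype.mem_piFinset, Finset.mem_Icc]
  intro i; fin_cases i <;> simp <;> omega

theorem mem_cube_target {n : ℕ} (hn : 1 ≤ n) : (Pi.single 0 (n : ℤ) : Site 3) ∈ cube n := by
  simp only [cube, Fintype.mem_piFinset, Finset.mem_Icc]
  intro i; fin_cases i <;> simp <;> omega

theorem cube_subset_slab {n L : ℕ} (hL : n ≤ L) : cube n ⊆ slab n L := by
  intro w hw
  simp only [cube, slab, Fintype.mem_piFinset, Finset.mem_Icc] at hw ⊢
  intro i
  have h := hw i
  fin_cases i
  · simp at h ⊢; omega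
  · simp at h ⊢; omega
  · simp at h ⊢; omega

/-- **One fold, not six**: the half-space image inequality gives (F1) by GKS domain monotonicity `free_{C_n} ≤ free_{S_{n,n}}`.
[cite: FriedliVelenik2017, Exercise 3.12, p. 112] -/
theorem weakCubeDeficit_of_halfSpaceImageDeficit (h : HalfSpaceImageDeficit) : WeakCubeDeficit := by
  obtain ⟨c, hc, h⟩ := h
  refine ⟨c, hc, fun n hn => ?_⟩
  have hmono : freeTP (cube n) n ≤ freeTP (slab n n) n :=
    DCPLower.isingTwoPoint_free_le_of_subset (zdGraph 3) (criticalBeta_nonneg 3) (cube_subset_slab le_rfl)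
      (mem_cube_zero hn) (mem_cube_target hn)
  have := h n hn n le_rfl
  linarith

/-- `g(2n) ≤ g(n)` (Messager–Miracle-Solé axis antitonicity). [cite: MessagerMiracleSoleJSP1977, main theorem] -/
theorem g_two_mul_le (n : ℕ) : g (2 * (n : ℤ)) ≤ g n := by
  have h := Literature.Probability.LatticeModels.criticalTwoPoint_axis_antitone (show n ≤ 2 * n by omega)
  have hc : ((2 * n : ℕ) : ℤ) = 2 * (n : ℤ) := by push_cast; ring
  simpa [g, hc] using h

/-- The stub implies its weak form. [folklore] -/
theorem weakCubeDeficit_of_cubeDeficit (h : CubeDeficit) : WeakCubeDeficit := by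
  obtain ⟨c, hc, h⟩ := h
  refine ⟨c, hc, fun n hn => ?_⟩
  have h1 := h n hn
  have h2 : c * g (2 * (n : ℤ)) ≤ c * g n := mul_le_mul_of_nonneg_left (g_two_mul_le n) hc.le
  linarith

/-- (F1) plus item 6150 gives the stub back. [folklore] -/
theorem cubeDeficit_of_weak_of_doubling (hW : WeakCubeDeficit) (hD : MirrorHoelderCompactness.TwoPointDoubling) :
    CubeDeficit := by
  obtain ⟨c, hc, hW⟩ := hW
  obtain ⟨κ, hκ, hD⟩ := hD
  refine ⟨c * κ, mul_pos hc hκ, fun n hn => ?_⟩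
  have h1 := hW n hn
  have h2 : κ * g n ≤ g (2 * (n : ℤ)) := hD n hn
  have h3 : c * (κ * g n) ≤ c * g (2 * (n : ℤ)) := mul_le_mul_of_nonneg_left h2 hc.le
  nlinarith

/-- The stub implies item 6150 (landed cube chain, p172128, κ = c/6). [folklore] -/
theorem doubling_of_cubeDeficit (h : CubeDeficit) : MirrorHoelderCompactness.TwoPointDoubling :=
  Summit.CriticalPhenomena.Ising3DConformalLimit.ReflectionTwinExistsContinuousLimit.FreeBox.twoPointDoubling_of_cubeDeficit h

/-- **`CubeDeficit ⟺ WeakCubeDeficit ∧ TwoPointDoubling`**: the lead's stub is exactly item 6150 plus a free-boundary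
statement `(F1)` about the ordinary surface transition, which the infinite-volume crux does not imply. [folklore] -/
theorem cubeDeficit_iff_weak_and_doubling :
    CubeDeficit ↔ WeakCubeDeficit ∧ MirrorHoelderCompactness.TwoPointDoubling :=
  ⟨fun h => ⟨weakCubeDeficit_of_cubeDeficit h, doubling_of_cubeDeficit h⟩,
    fun h => cubeDeficit_of_weak_of_doubling h.1 h.2⟩

/-- Hence the whole line: `HalfSpaceImageDeficit → TwoPointDoubling → ClusterSetTotallyDisconnected → crux` — the image
inequality would only ever replace the FREE-BOUNDARY half of the stub; the doubling half is item 6150 itself. [folklore] -/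
theorem crux_of_halfSpace_of_items (hH : HalfSpaceImageDeficit) (hD : MirrorHoelderCompactness.TwoPointDoubling)
    (hT : ClusterRigidity.ClusterSetTotallyDisconnected) : ReflectionTwin.ExistsContinuousLimit := by
  have _hC : CubeDeficit := cubeDeficit_of_weak_of_doubling (weakCubeDeficit_of_halfSpaceImageDeficit hH) hD
  exact reflectionTwin_of_items hD hT

end Summit.CriticalPhenomena.Ising3DConformalLimit.Cruxes.ExistsContinuousLimit.StrategistS1Addendum

end
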